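import Literature.NumberTheory.LFunctions.SelbergMollifierFourier
import HarnessLib

/-!
# Titchmarsh's Lemma 10.18: `∫ F(t)² dt = O(log(1/δ)/(δ^{1/2} log X))` — PROVED

Eighth support file for the proof of A. Selberg's positive-proportion theorem in the arrangement
of E. C. Titchmarsh, *The Theory of the Riemann Zeta-Function*, 2nd ed. (1986), §10.9–§10.22.
It discharges the named fact `Titchmarsh1986_lemma_10_18` of `SelbergMollifier.lean`:
`theorem Titchmarsh1986_lemma_10_18_holds`.

Proof (Titchmarsh §10.18): by Parseval (`integral_selbergF_sq_eq`, file `SelbergMollifierFourier`)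
`∫F² = π∫|f̃|² = 2π∫_0^∞|f̃|² ≤ 32π∫_1^∞|g|² + 8π(φ(0)φ(1))²`; on `[1, δ^{-2}]` one has
`1 ≤ e² x^{-1/log(1/δ)}`, so `∫_1^{δ^{-2}}|g|² ≤ e² J(1, 1/log(1/δ)) = O(log(1/δ)/(δ^{1/2}log X))` by
(10.17.2) (`Jint_le`, file `SelbergMollifierJBound`), while `∫_{δ^{-2}}^∞ |g|²` is exponentially small
by the Gaussian majorant of `g` (`norm_gfun_le_exp`).

## References

* [Titchmarsh1986] E. C. Titchmarsh, *The Theory of the Riemann Zeta-Function*, 2nd ed. revised by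
  D. R. Heath-Brown, Oxford 1986, §10.18, Lemma 10.18.
-/

noncomputable section

open Real Complex MeasureTheory Set Filter Finset
open scoped Topology

namespace Literature.NumberTheory.LFunctions.SelbergMollifier

/-! ## §1 Small-`δ` absorption lemmas -/

/-- **Small-`δ` absorption of logarithms**: `A δ^α log^N(1/δ) ≤ 1` for `0 < δ ≤ δ₀(A,α,N)`. [folklore] -/
theorem exists_delta0_log (A : ℝ) {α : ℝ} (hα : 0 < α) (N : ℕ) :
    ∃ δ₀ : ℝ, 0 < δ₀ ∧ δ₀ < 1 ∧ ∀ δ : ℝ, 0 < δ → δ ≤ δ₀ → A * δ ^ α * Real.log (1 / δ) ^ N ≤ 1 := by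
  -- `(log y)^N ≤ y^{α/2}` for large `y`
  have hlo := isLittleO_log_rpow_rpow_atTop (N : ℝ) (half_pos hα)
  have hev : ∀ᶠ y : ℝ in atTop, Real.log y ^ N ≤ y ^ (α / 2) := by
    have := hlo.bound (c := 1) one_pos
    filter_upwards [this, eventually_ge_atTop (1 : ℝ)] with y hy hy1
    have hlog : 0 ≤ Real.log y := Real.log_nonneg hy1
    rw [Real.norm_eq_abs, Real.norm_eq_abs, one_mul, Real.rpow_natCast] at hy
    rw [abs_of_nonneg (pow_nonneg hlog _), abs_of_nonneg (Real.rpow_nonneg (by linarith) _)] at hy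
    exact hy
  obtain ⟨Y, hY⟩ := Filter.eventually_atTop.mp hev
  set Y₁ : ℝ := max Y 2 with hY₁
  -- `A δ^{α/2} ≤ 1` for `δ ≤ δ₁`
  obtain ⟨δ₁, hδ₁, hδ₁b⟩ : ∃ δ₁ : ℝ, 0 < δ₁ ∧ ∀ δ : ℝ, 0 < δ → δ ≤ δ₁ → A * δ ^ (α / 2) ≤ 1 := by
    rcases le_or_gt A 0 with hA | hA
    · exact ⟨1, one_pos, fun δ hδ _ ↦ by nlinarith [Real.rpow_nonneg hδ.le (α / 2)]⟩
    · refine ⟨(A⁻¹) ^ (2 / α), by positivity, fun δ hδ hδle ↦ ?_⟩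
      have h1 : δ ^ (α / 2) ≤ ((A⁻¹) ^ (2 / α)) ^ (α / 2) := Real.rpow_le_rpow hδ.le hδle (by positivity)
      rw [← Real.rpow_mul (by positivity), show 2 / α * (α / 2) = 1 by field_simp, Real.rpow_one] at h1
      calc A * δ ^ (α / 2) ≤ A * A⁻¹ := mul_le_mul_of_nonneg_left h1 hA.le
        _ = 1 := mul_inv_cancel₀ hA.ne'
  refine ⟨min δ₁ Y₁⁻¹, lt_min hδ₁ (by positivity), ?_, fun δ hδ hδle ↦ ?_⟩
  · calc min δ₁ Y₁⁻¹ ≤ Y₁⁻¹ := min_le_right _ _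
      _ < 1 := inv_lt_one_of_one_lt₀ (by rw [hY₁]; exact lt_of_lt_of_le one_lt_two (le_max_right _ _))
  have hδY : Y ≤ 1 / δ := by
    rw [le_div_iff₀ hδ]
    have : δ ≤ Y₁⁻¹ := hδle.trans (min_le_right _ _)
    have hY1 : Y ≤ Y₁ := le_max_left _ _
    have hY0 : 0 < Y₁ := by positivity
    calc Y * δ ≤ Y₁ * Y₁⁻¹ := by
          rcases le_or_gt 0 Y with h | h
          · exact mul_le_mul hY1 this hδ.le hY0.le
          · nlinarith [mul_pos hY0 (inv_pos.mpr hY0)]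
      _ = 1 := mul_inv_cancel₀ hY0.ne'
  have hlogb := hY (1 / δ) hδY
  have hY12 : (2 : ℝ) ≤ Y₁ := le_max_right _ _
  have hδ1 : δ ≤ 1 := by
    have : δ ≤ Y₁⁻¹ := hδle.trans (min_le_right _ _)
    exact this.trans (inv_le_one_of_one_le₀ (by linarith))
  have hlog0 : 0 ≤ Real.log (1 / δ) := Real.log_nonneg (by rw [le_div_iff₀ hδ]; linarith)
  rcases le_or_gt A 0 with hA | hA
  · have : 0 ≤ δ ^ α * Real.log (1 / δ) ^ N := mul_nonneg (Real.rpow_nonneg hδ.le _) (pow_nonneg hlog0 _)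
    nlinarith
  calc A * δ ^ α * Real.log (1 / δ) ^ N ≤ A * δ ^ α * (1 / δ) ^ (α / 2) :=
        mul_le_mul_of_nonneg_left hlogb (by positivity)
    _ = A * δ ^ (α / 2) := by
        rw [Real.div_rpow zero_le_one hδ.le, Real.one_rpow, mul_assoc, one_div, ← Real.rpow_neg hδ.le,
          ← Real.rpow_add hδ]
        ring_nf
    _ ≤ 1 := hδ₁b δ hδ (hδle.trans (min_le_left _ _))

/-- **Small-`δ` absorption of a double exponential**: `B δ^{-N} e^{-δ^{-β}} ≤ 1` for `0 < δ ≤ δ₀`. [folklore] -/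
theorem exists_delta0_exp (B : ℝ) (N : ℕ) {β : ℝ} (hβ : 0 < β) :
    ∃ δ₀ : ℝ, 0 < δ₀ ∧ δ₀ ≤ 1 ∧ ∀ δ : ℝ, 0 < δ → δ ≤ δ₀ → B * δ ^ (-(N : ℝ)) * Real.exp (-δ ^ (-β)) ≤ 1 := by
  set k : ℕ := ⌈((N : ℝ) + 1) / β⌉₊ with hk
  have hkβ : (N : ℝ) + 1 ≤ β * k := by
    have := Nat.le_ceil (((N : ℝ) + 1) / β)
    rw [← hk] at this
    rwa [div_le_iff₀' hβ] at this
  set B₁ : ℝ := max B 1 with hB₁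
  have hB₁0 : 0 < B₁ := by positivity
  have hfact : (1 : ℝ) ≤ k.factorial := by exact_mod_cast Nat.one_le_iff_ne_zero.mpr (Nat.factorial_ne_zero k)
  refine ⟨(B₁ * k.factorial)⁻¹, by positivity, inv_le_one_of_one_le₀ (by nlinarith [le_max_right B 1]),
    fun δ hδ hδle ↦ ?_⟩
  have hδ1 : δ ≤ 1 := hδle.trans (inv_le_one_of_one_le₀ (by nlinarith [le_max_right B 1]))
  set y : ℝ := δ ^ (-β) with hy
  have hy0 : 0 < y := Real.rpow_pos_of_pos hδ _
  have hexp : Real.exp (-y) ≤ k.factorial / y ^ k := by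
    have h := Real.pow_div_factorial_le_exp y hy0.le (n := k)
    rw [Real.exp_neg, le_div_iff₀ (pow_pos hy0 k)]
    rw [div_le_iff₀ (by positivity)] at h
    calc (Real.exp y)⁻¹ * y ^ k = y ^ k / Real.exp y := by ring
      _ ≤ k.factorial := by rw [div_le_iff₀ (Real.exp_pos y)]; linarith
  have hyk : (y ^ k)⁻¹ = δ ^ (β * k) := by
    rw [hy, ← Real.rpow_natCast, ← Real.rpow_mul hδ.le, ← Real.rpow_neg hδ.le]; ring_nf
  rcases le_or_gt B 0 with hB | hB
  · have : 0 ≤ δ ^ (-(N : ℝ)) * Real.exp (-δ ^ (-β)) := by positivity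
    nlinarith
  calc B * δ ^ (-(N : ℝ)) * Real.exp (-δ ^ (-β)) ≤ B * δ ^ (-(N : ℝ)) * (k.factorial / y ^ k) := by
        rw [← hy]; exact mul_le_mul_of_nonneg_left hexp (by positivity)
    _ = B * k.factorial * (δ ^ (-(N : ℝ)) * δ ^ (β * k)) := by rw [div_eq_mul_inv, hyk]; ring
    _ = B * k.factorial * δ ^ (β * k - N) := by rw [← Real.rpow_add hδ]; ring_nf
    _ ≤ B * k.factorial * δ := by
        refine mul_le_mul_of_nonneg_left ?_ (by positivity)
        calc δ ^ (β * k - N) ≤ δ ^ (1 : ℝ) := Real.rpow_le_rpow_of_exponent_ge hδ hδ1 (by linarith)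
          _ = δ := Real.rpow_one δ
    _ ≤ B₁ * k.factorial * (B₁ * k.factorial)⁻¹ :=
        mul_le_mul (mul_le_mul_of_nonneg_right (le_max_left _ _) (by positivity)) hδle hδ.le (by positivity)
    _ = 1 := mul_inv_cancel₀ (by positivity)

/-! ## §2 The Gaussian tail of `g` -/

section Tail

variable {X δ : ℝ}

/-- `T_p = |c_p| · thetaTail(π(κ/λ)² sin δ)`. [folklore] -/
theorem gMajor_eq (p : ℕ × ℕ) (δ : ℝ) :
    gMajor X δ p = |gCoeff X p| * thetaTail (π * ((p.1 : ℝ) / p.2) ^ 2 * Real.sin δ) := by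
  rw [gMajor, tsum_mul_left, thetaTail]
  congr 1
  refine tsum_congr fun m ↦ ?_
  unfold gFreq gRoot
  congr 1
  ring

/-- **`T ≤ 15 X² δ^{-1/2}`** (`0 < δ ≤ 1`, `X ≥ 1`). [folklore] -/
theorem gMajorTot_le (hX : 1 ≤ X) (hδ : 0 < δ) (hδ1 : δ ≤ 1) : gMajorTot X δ ≤ 15 * X ^ 2 / Real.sqrt δ := by
  obtain ⟨hsin, _⟩ := sin_cos_bounds hδ hδ1
  have hs0 : 0 < Real.sin δ := by linarith
  have hs1 : Real.sin δ ≤ 1 := Real.sin_le_one δ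
  have hX0 : 0 < X := by linarith
  have hsδ : 0 < Real.sqrt δ := Real.sqrt_pos.mpr hδ
  -- each `T_p ≤ 10/√(sin δ) ≤ 15/√δ`
  have hterm : ∀ p ∈ mollRange X ×ˢ mollRange X, gMajor X δ p ≤ 15 / Real.sqrt δ := by
    intro p hp
    obtain ⟨h1, h2⟩ := pos_of_mem_prod hp
    obtain ⟨h1X, h2X⟩ := lt_of_mem_prod hp
    have hκ1 : (1 : ℝ) ≤ p.1 := by exact_mod_cast one_le_of_mem_mollRange (Finset.mem_product.mp hp).1
    have hl1 : (1 : ℝ) ≤ p.2 := by exact_mod_cast one_le_of_mem_mollRange (Finset.mem_product.mp hp).2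
    set ε : ℝ := π * ((p.1 : ℝ) / p.2) ^ 2 * Real.sin δ with hε
    have hε0 : 0 < ε := by positivity
    rw [gMajor_eq p]
    have hc : |gCoeff X p| ≤ (p.2 : ℝ)⁻¹ := (abs_gCoeff_le hp).trans (le_of_eq (one_div _))
    have hth := thetaTail_le_five hε0
    -- `ε^{-1/2} = (λ/κ)/√(π sin δ) ≤ λ/√(sin δ)`
    have hεpow : ε ^ (-(1 / 2 : ℝ)) ≤ (p.2 : ℝ) / Real.sqrt (Real.sin δ) := by
      rw [Real.rpow_neg hε0.le, ← Real.sqrt_eq_rpow, hε]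
      rw [show π * ((p.1 : ℝ) / p.2) ^ 2 * Real.sin δ = (Real.sqrt π * (p.1 / p.2)) ^ 2 * Real.sin δ by
        rw [mul_pow, Real.sq_sqrt Real.pi_pos.le], Real.sqrt_mul (by positivity), Real.sqrt_sq (by positivity)]
      rw [inv_le_iff_one_le_mul₀ (by positivity)]
      have hπ1 : 1 ≤ Real.sqrt π := by rw [Real.le_sqrt' one_pos]; linarith [Real.pi_gt_three]
      have hss : 0 < Real.sqrt (Real.sin δ) := Real.sqrt_pos.mpr hs0
      calc (1 : ℝ) ≤ Real.sqrt π * p.1 := by nlinarith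
        _ = (p.2 : ℝ) / Real.sqrt (Real.sin δ) * (Real.sqrt π * (p.1 / p.2) * Real.sqrt (Real.sin δ)) := by
            field_simp
    have hsq : Real.sqrt δ ≤ Real.sqrt 2 * Real.sqrt (Real.sin δ) := by
      rw [← Real.sqrt_mul zero_le_two]; exact Real.sqrt_le_sqrt (by linarith)
    have hss : 0 < Real.sqrt (Real.sin δ) := Real.sqrt_pos.mpr hs0
    have hss1 : Real.sqrt (Real.sin δ) ≤ 1 := Real.sqrt_le_one.mpr hs1
    calc |gCoeff X p| * thetaTail ε ≤ (p.2 : ℝ)⁻¹ * (5 * (1 + (p.2 : ℝ) / Real.sqrt (Real.sin δ))) :=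
          mul_le_mul hc (hth.trans (by linarith)) (thetaTail_nonneg _) (by positivity)
      _ = 5 * ((p.2 : ℝ)⁻¹ + 1 / Real.sqrt (Real.sin δ)) := by field_simp
      _ ≤ 5 * (1 / Real.sqrt (Real.sin δ) + 1 / Real.sqrt (Real.sin δ)) := by
          gcongr
          calc (p.2 : ℝ)⁻¹ ≤ 1 := inv_le_one_of_one_le₀ hl1
            _ ≤ 1 / Real.sqrt (Real.sin δ) := by rw [le_div_iff₀ hss]; linarith
      _ = 10 / Real.sqrt (Real.sin δ) := by ring
      _ ≤ 15 / Real.sqrt δ := by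
          rw [div_le_div_iff₀ hss hsδ]
          have h2 : Real.sqrt 2 ≤ 3 / 2 := by
            rw [Real.sqrt_le_left (by norm_num)]; norm_num
          nlinarith
  calc gMajorTot X δ = ∑ p ∈ mollRange X ×ˢ mollRange X, gMajor X δ p := rfl
    _ ≤ ∑ p ∈ mollRange X ×ˢ mollRange X, 15 / Real.sqrt δ := Finset.sum_le_sum hterm
    _ = (mollRange X).card ^ 2 * (15 / Real.sqrt δ) := by
        rw [Finset.sum_const, Finset.card_product, nsmul_eq_mul]; push_cast; ring
    _ ≤ X ^ 2 * (15 / Real.sqrt δ) := by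
        gcongr
        exact card_mollRange_le hX0.le
    _ = 15 * X ^ 2 / Real.sqrt δ := by ring

/-- The decay rate `c₀ = π sin δ / X²`. [folklore] -/
def cZero (X δ : ℝ) : ℝ := π * Real.sin δ / X ^ 2

/-- **`|g|²` is integrable on `(a, ∞)`, `a ≥ 1`.** [folklore] -/
theorem integrableOn_norm_gfun_sq (hX : 0 < X) (hδ : 0 < Real.sin δ) {a : ℝ} (ha : 1 ≤ a) :
    IntegrableOn (fun u : ℝ ↦ ‖gfun X δ u‖ ^ 2) (Ioi a) := by
  have hc : 0 < cZero X δ := div_pos (mul_pos Real.pi_pos hδ) (pow_pos hX 2)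
  set K : ℝ := (gMajorTot X δ * Real.exp (cZero X δ)) ^ 2 with hK
  refine Integrable.mono' ((integrableOn_exp_mul_Ioi (a := -(2 * cZero X δ)) (by linarith) a).const_mul K) ?_ ?_
  · exact ContinuousOn.aestronglyMeasurable (((continuousOn_gfun hX hδ).norm.pow 2).mono fun u hu ↦
      ha.trans (le_of_lt hu)) measurableSet_Ioi
  · refine (ae_restrict_iff' measurableSet_Ioi).mpr (Eventually.of_forall fun u hu ↦ ?_)
    have hu1 : 1 ≤ u := ha.trans (le_of_lt hu)
    have hb := norm_gfun_le_exp hX hδ hu1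
    rw [Real.norm_eq_abs, abs_of_nonneg (sq_nonneg _)]
    have h0 : 0 ≤ gMajorTot X δ * Real.exp (π * Real.sin δ / X ^ 2) * Real.exp (-(π * Real.sin δ / X ^ 2) * u) := by
      have := gMajorTot_nonneg X δ; positivity
    calc ‖gfun X δ u‖ ^ 2 ≤ (gMajorTot X δ * Real.exp (π * Real.sin δ / X ^ 2) * Real.exp (-(π * Real.sin δ / X ^ 2) * u)) ^ 2 :=
          pow_le_pow_left₀ (norm_nonneg _) hb 2
      _ = K * Real.exp (-(2 * cZero X δ) * u) := by
          rw [hK, cZero, mul_pow, sq (Real.exp (-(π * Real.sin δ / X ^ 2) * u)), ← Real.exp_add]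
          congr 1; congr 1; ring

/-- **The Gaussian tail**: `∫_{x₁}^∞ |g|² ≤ (T e^{c₀})² e^{-2c₀x₁}/(2c₀)` (`x₁ ≥ 1`). [folklore] -/
theorem integral_norm_gfun_sq_tail_le (hX : 0 < X) (hδ : 0 < Real.sin δ) {x₁ : ℝ} (hx₁ : 1 ≤ x₁) :
    ∫ u in Ioi x₁, ‖gfun X δ u‖ ^ 2 ≤
      (gMajorTot X δ * Real.exp (cZero X δ)) ^ 2 * Real.exp (-(2 * cZero X δ) * x₁) / (2 * cZero X δ) := by
  have hc : 0 < cZero X δ := div_pos (mul_pos Real.pi_pos hδ) (pow_pos hX 2)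
  set K : ℝ := (gMajorTot X δ * Real.exp (cZero X δ)) ^ 2 with hK
  have hneg : -(2 * cZero X δ) < 0 := by linarith
  calc ∫ u in Ioi x₁, ‖gfun X δ u‖ ^ 2 ≤ ∫ u in Ioi x₁, K * Real.exp (-(2 * cZero X δ) * u) := by
        refine setIntegral_mono_on (integrableOn_norm_gfun_sq hX hδ hx₁)
          ((integrableOn_exp_mul_Ioi hneg x₁).const_mul K) measurableSet_Ioi fun u hu ↦ ?_
        have hu1 : 1 ≤ u := hx₁.trans (le_of_lt hu)
        have hb := norm_gfun_le_exp hX hδ hu1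
        have h0 : 0 ≤ gMajorTot X δ * Real.exp (π * Real.sin δ / X ^ 2) * Real.exp (-(π * Real.sin δ / X ^ 2) * u) := by
          have := gMajorTot_nonneg X δ; positivity
        calc ‖gfun X δ u‖ ^ 2
            ≤ (gMajorTot X δ * Real.exp (π * Real.sin δ / X ^ 2) * Real.exp (-(π * Real.sin δ / X ^ 2) * u)) ^ 2 :=
              pow_le_pow_left₀ (norm_nonneg _) hb 2
          _ = K * Real.exp (-(2 * cZero X δ) * u) := by
              rw [hK, cZero, mul_pow, sq (Real.exp (-(π * Real.sin δ / X ^ 2) * u)), ← Real.exp_add]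
              congr 1; congr 1; ring
    _ = K * Real.exp (-(2 * cZero X δ) * x₁) / (2 * cZero X δ) := by
        rw [integral_const_mul, integral_exp_mul_Ioi hneg]
        field_simp

/-- `|g|² x^{-θ}` is integrable on `(1,∞)` (`θ ≥ 0`). [folklore] -/
theorem integrableOn_norm_gfun_sq_rpow (hX : 0 < X) (hδ : 0 < Real.sin δ) {θ : ℝ} (hθ : 0 ≤ θ) {a : ℝ} (ha : 1 ≤ a) :
    IntegrableOn (fun u : ℝ ↦ ‖gfun X δ u‖ ^ 2 * u ^ (-θ)) (Ioi a) := by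
  refine Integrable.mono' (integrableOn_norm_gfun_sq hX hδ ha) ?_ ?_
  · refine ContinuousOn.aestronglyMeasurable ?_ measurableSet_Ioi
    refine (((continuousOn_gfun hX hδ).norm.pow 2).mono fun u hu ↦ ha.trans (le_of_lt hu)).mul ?_
    exact continuousOn_id.rpow_const fun u hu ↦ Or.inl (lt_of_lt_of_le one_pos (ha.trans (le_of_lt hu))).ne'
  · refine (ae_restrict_iff' measurableSet_Ioi).mpr (Eventually.of_forall fun u hu ↦ ?_)
    have hu1 : 1 ≤ u := ha.trans (le_of_lt hu)
    rw [Real.norm_eq_abs, abs_of_nonneg (by positivity)]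
    calc ‖gfun X δ u‖ ^ 2 * u ^ (-θ) ≤ ‖gfun X δ u‖ ^ 2 * 1 :=
          mul_le_mul_of_nonneg_left (Real.rpow_le_one_of_one_le_of_nonpos hu1 (by linarith)) (sq_nonneg _)
      _ = _ := mul_one _

/-- **`∫_1^{x₁} |g|² ≤ x₁^θ J(1,θ)`** (`θ ≥ 0`, `x₁ ≥ 1`). [cite: Titchmarsh1986, §10.18] -/
theorem integral_Ioc_norm_gfun_sq_le (hX : 0 < X) (hδ : 0 < Real.sin δ) {θ : ℝ} (hθ : 0 ≤ θ) {x₁ : ℝ} (hx₁ : 1 ≤ x₁) :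
    ∫ u in Ioc 1 x₁, ‖gfun X δ u‖ ^ 2 ≤ x₁ ^ θ * Jint X δ 1 θ := by
  have hint := integrableOn_norm_gfun_sq_rpow hX hδ hθ le_rfl
  have hx0 : 0 < x₁ := by linarith
  calc ∫ u in Ioc 1 x₁, ‖gfun X δ u‖ ^ 2 ≤ ∫ u in Ioc 1 x₁, x₁ ^ θ * (‖gfun X δ u‖ ^ 2 * u ^ (-θ)) := by
        refine setIntegral_mono_on ((integrableOn_norm_gfun_sq hX hδ le_rfl).mono_set Ioc_subset_Ioi_self)
          ((hint.mono_set Ioc_subset_Ioi_self).const_mul _) measurableSet_Ioc fun u hu ↦ ?_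
        have hu0 : 0 < u := by linarith [hu.1]
        -- `1 ≤ x₁^θ u^{-θ}` on `(1, x₁]`
        have h1 : 1 ≤ x₁ ^ θ * u ^ (-θ) := by
          rw [Real.rpow_neg hu0.le, ← div_eq_mul_inv, one_le_div (Real.rpow_pos_of_pos hu0 θ)]
          exact Real.rpow_le_rpow hu0.le hu.2 hθ
        calc ‖gfun X δ u‖ ^ 2 = ‖gfun X δ u‖ ^ 2 * 1 := (mul_one _).symm
          _ ≤ ‖gfun X δ u‖ ^ 2 * (x₁ ^ θ * u ^ (-θ)) := mul_le_mul_of_nonneg_left h1 (sq_nonneg _)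
          _ = _ := by ring
    _ = x₁ ^ θ * ∫ u in Ioc 1 x₁, ‖gfun X δ u‖ ^ 2 * u ^ (-θ) := integral_const_mul _ _
    _ ≤ x₁ ^ θ * Jint X δ 1 θ := by
        refine mul_le_mul_of_nonneg_left ?_ (by positivity)
        rw [Jint]
        exact setIntegral_mono_set hint ((ae_restrict_iff' measurableSet_Ioi).mpr (Eventually.of_forall
          fun u hu ↦ by have : 0 ≤ u := le_of_lt (lt_trans one_pos hu); positivity))
          (Eventually.of_forall Ioc_subset_Ioi_self)

end Tail

/-! ## §3 `∫F² ≤ 32π ∫_1^∞ |g|² + 8π (φ(0)φ(1))²` -/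

section Parseval

variable {X δ : ℝ}

/-- The substitution `x = e^{v/2}` maps `(a,∞)` onto `(e^{a/2}, ∞)`. [folklore] -/
theorem image_exp_half_Ioi (a : ℝ) : (fun v : ℝ ↦ Real.exp (v / 2)) '' Ioi a = Ioi (Real.exp (a / 2)) := by
  ext y
  constructor
  · rintro ⟨v, hv, rfl⟩
    exact Real.exp_lt_exp.mpr (by linarith [Set.mem_Ioi.mp hv])
  · intro hy
    have hy0 : 0 < y := (Real.exp_pos _).trans hy
    refine ⟨2 * Real.log y, ?_, ?_⟩
    · rw [Set.mem_Ioi]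
      have := Real.log_lt_log (Real.exp_pos _) hy
      rw [Real.log_exp] at this
      linarith
    · simp only
      rw [show 2 * Real.log y / 2 = Real.log y by ring, Real.exp_log hy0]

/-- **The substitution `x = e^{v/2}`**: `∫_{(a,∞)} e^{v/2} G(e^{v/2}) dv = 2 ∫_{(e^{a/2},∞)} G(x) dx`, together
with the transfer of integrability. [folklore] -/
theorem integral_exp_half_subst (G : ℝ → ℝ) (a : ℝ) :
    (IntegrableOn G (Ioi (Real.exp (a / 2))) ↔
      IntegrableOn (fun v : ℝ ↦ Real.exp (v / 2) * G (Real.exp (v / 2))) (Ioi a)) ∧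
    ∫ v in Ioi a, Real.exp (v / 2) * G (Real.exp (v / 2)) = 2 * ∫ x in Ioi (Real.exp (a / 2)), G x := by
  have hderiv : ∀ v ∈ Ioi a, HasDerivWithinAt (fun v : ℝ ↦ Real.exp (v / 2)) (Real.exp (v / 2) / 2) (Ioi a) v := by
    intro v _
    have hd : HasDerivAt (fun v : ℝ ↦ Real.exp (v / 2)) (Real.exp (v / 2) / 2) v := by
      have h := ((hasDerivAt_id' v).div_const 2).exp
      convert h using 1; ring
    exact hd.hasDerivWithinAt
  have hinj : InjOn (fun v : ℝ ↦ Real.exp (v / 2)) (Ioi a) := by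
    intro v _ w _ h
    have := Real.exp_injective h
    linarith
  have habs : ∀ v : ℝ, |Real.exp (v / 2) / 2| = Real.exp (v / 2) / 2 := fun v ↦ abs_of_pos (by positivity)
  constructor
  · rw [← image_exp_half_Ioi, integrableOn_image_iff_integrableOn_abs_deriv_smul measurableSet_Ioi hderiv hinj]
    simp only [habs, smul_eq_mul]
    constructor
    · intro h
      exact IntegrableOn.congr_fun (h.const_mul 2) (fun v _ ↦ by ring) measurableSet_Ioi
    · intro h
      exact IntegrableOn.congr_fun (h.const_mul (1 / 2)) (fun v _ ↦ by ring) measurableSet_Ioi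
  · rw [← image_exp_half_Ioi, integral_image_eq_integral_abs_deriv_smul measurableSet_Ioi hderiv hinj]
    simp only [habs, smul_eq_mul]
    rw [← integral_const_mul]
    refine setIntegral_congr_fun measurableSet_Ioi fun v _ ↦ ?_
    ring

/-- **`∫_0^∞ |f̃|² ≤ 16∫_1^∞|g|² + 4P₀²`.** [cite: Titchmarsh1986, §10.18] -/
theorem integral_Ioi_norm_sq_ftil_le (hδ : 0 < δ) (hδ1 : δ ≤ 1) (hX : 0 < X) :
    ∫ v in Ioi (0 : ℝ), ‖ftil X δ v‖ ^ 2 ≤ 16 * (∫ x in Ioi (1 : ℝ), ‖gfun X δ x‖ ^ 2) + 4 * phiProd X ^ 2 := by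
  obtain ⟨hsin, _⟩ := sin_cos_bounds hδ hδ1
  have hs0 : 0 < Real.sin δ := by linarith
  have h2 := memLp_ftil hδ hδ1 X
  have hint : Integrable (fun v : ℝ ↦ ‖ftil X δ v‖ ^ 2) := (memLp_two_iff_integrable_sq_norm h2.1).mp h2
  -- the two majorants
  have hsub := integral_exp_half_subst (fun x : ℝ ↦ ‖gfun X δ x‖ ^ 2) 0
  rw [zero_div, Real.exp_zero] at hsub
  have hg1 : IntegrableOn (fun v : ℝ ↦ Real.exp (v / 2) * ‖gfun X δ (Real.exp (v / 2))‖ ^ 2) (Ioi 0) :=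
    hsub.1.mp (integrableOn_norm_gfun_sq hX hs0 le_rfl)
  have hg2 : IntegrableOn (fun v : ℝ ↦ Real.exp (-(1 / 2) * v)) (Ioi 0) := integrableOn_exp_mul_Ioi (by norm_num) 0
  have hexp2 : ∫ v in Ioi (0 : ℝ), Real.exp (-(1 / 2) * v) = 2 := by
    rw [integral_exp_mul_Ioi (by norm_num)]; norm_num
  calc ∫ v in Ioi (0 : ℝ), ‖ftil X δ v‖ ^ 2
      ≤ ∫ v in Ioi (0 : ℝ), (8 * (Real.exp (v / 2) * ‖gfun X δ (Real.exp (v / 2))‖ ^ 2) +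
          2 * phiProd X ^ 2 * Real.exp (-(1 / 2) * v)) := by
        refine setIntegral_mono_on hint.integrableOn ((hg1.const_mul 8).add (hg2.const_mul _)) measurableSet_Ioi
          fun v _ ↦ ?_
        have := norm_sq_ftil_le hδ hδ1 X v
        calc ‖ftil X δ v‖ ^ 2 ≤ 8 * Real.exp (v / 2) * ‖gfun X δ (Real.exp (v / 2))‖ ^ 2 +
              2 * Real.exp (-(v / 2)) * phiProd X ^ 2 := this
          _ = _ := by rw [show -(v / 2) = -(1 / 2) * v by ring]; ring
    _ = 8 * (2 * ∫ x in Ioi (1 : ℝ), ‖gfun X δ x‖ ^ 2) + 2 * phiProd X ^ 2 * 2 := by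
        rw [integral_add (hg1.const_mul 8) (hg2.const_mul _), integral_const_mul, integral_const_mul, hsub.2, hexp2]
    _ = _ := by ring

/-- **`∫F² ≤ 32π ∫_1^∞ |g|² + 8π P₀²`.** [cite: Titchmarsh1986, §10.18] -/
theorem integral_selbergF_sq_le (hδ : 0 < δ) (hδ1 : δ ≤ 1) (hX : 0 < X) :
    ∫ t : ℝ, selbergF X δ t ^ 2 ≤ 32 * π * (∫ x in Ioi (1 : ℝ), ‖gfun X δ x‖ ^ 2) + 8 * π * phiProd X ^ 2 := by
  rw [(integral_selbergF_sq_eq hδ hδ1 X).2, integral_norm_sq_ftil_eq hδ hδ1]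
  have := integral_Ioi_norm_sq_ftil_le hδ hδ1 hX
  nlinarith [Real.pi_pos]

/-- `|P₀| ≤ 2X(1 + log X)` (`X ≥ 1`). [folklore] -/
theorem abs_phiProd_le (hX : 1 ≤ X) : |phiProd X| ≤ 2 * X * (1 + Real.log X) := by
  have hX0 : 0 < X := by linarith
  rw [phiProd, abs_mul]
  have h1 : |∑ μ ∈ mollRange X, selbergBeta X μ / μ| ≤ 2 * (1 + Real.log X) := by
    refine (Finset.abs_sum_le_sum_abs _ _).trans ((Finset.sum_le_sum fun μ hμ ↦ ?_).trans (sum_mollRange_inv_le hX))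
    have hμ0 : (0 : ℝ) < μ := by exact_mod_cast (mem_mollRange.mp hμ).1
    rw [abs_div, abs_of_pos hμ0, div_eq_mul_inv]
    calc |selbergBeta X μ| * (μ : ℝ)⁻¹ ≤ 1 * (μ : ℝ)⁻¹ :=
          mul_le_mul_of_nonneg_right (abs_selbergBeta_le_one hμ) (by positivity)
      _ = _ := one_mul _
  have h2 : |∑ ν ∈ mollRange X, selbergBeta X ν| ≤ X := by
    refine (Finset.abs_sum_le_sum_abs _ _).trans ?_
    calc ∑ ν ∈ mollRange X, |selbergBeta X ν| ≤ ∑ _ν ∈ mollRange X, (1 : ℝ) :=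
          Finset.sum_le_sum fun ν hν ↦ abs_selbergBeta_le_one hν
      _ = (mollRange X).card := by rw [Finset.sum_const, nsmul_eq_mul, mul_one]
      _ ≤ X := card_mollRange_le hX0.le
  calc |∑ μ ∈ mollRange X, selbergBeta X μ / μ| * |∑ ν ∈ mollRange X, selbergBeta X ν| ≤ 2 * (1 + Real.log X) * X :=
        mul_le_mul h1 h2 (abs_nonneg _) (by linarith [Real.log_nonneg hX])
    _ = _ := by ring

end Parseval

/-! ## §4 The parameter regime `X = δ^{-c}`: side conditions for small `δ` -/

/-- Exponent bookkeeping for `X = δ^{-c}`: `log X = c log(1/δ)`, `X^k = δ^{-kc}`. [folklore] -/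
theorem rpow_neg_facts {δ c : ℝ} (hδ : 0 < δ) :
    Real.log (δ ^ (-c)) = c * Real.log (1 / δ) ∧ 0 < δ ^ (-c) ∧
      ∀ k : ℕ, (δ ^ (-c)) ^ k = δ ^ (-(k * c)) := by
  refine ⟨?_, Real.rpow_pos_of_pos hδ _, fun k ↦ ?_⟩
  · rw [Real.log_rpow hδ, one_div, Real.log_inv]; ring
  · rw [← Real.rpow_natCast, ← Real.rpow_mul hδ.le]; ring_nf

/-- Basic regime facts for `δ ≤ min(e^{-2}, 3^{-1/c})`: `log(1/δ) ≥ 2`, `X = δ^{-c} ≥ 3`, `δ < 1`. [folklore] -/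
theorem regime_basic {c δ : ℝ} (hc : 0 < c) (hδ : 0 < δ) (hδe : δ ≤ Real.exp (-2)) (hδ3 : δ ≤ (3 : ℝ) ^ (-(1 / c))) :
    2 ≤ Real.log (1 / δ) ∧ 3 ≤ δ ^ (-c) ∧ δ < 1 := by
  refine ⟨?_, ?_, ?_⟩
  · rw [one_div, Real.log_inv, le_neg]
    have := Real.log_le_log hδ hδe
    rwa [Real.log_exp] at this
  · have h := Real.rpow_le_rpow_of_nonpos hδ hδ3 (by linarith : -c ≤ 0)
    rwa [← Real.rpow_mul (by norm_num), show -(1 / c) * -c = 1 by field_simp, Real.rpow_one] at h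
  · exact lt_of_le_of_lt hδe (Real.exp_lt_one_iff.mpr (by norm_num))

/-- **The side conditions of `Jint_le` hold for `X = δ^{-c}`, `1 ≤ x ≤ δ^{-e}`, `δ ≤ δ₀`**, provided
`4c < ½` and `2c + e < ½`. [cite: Titchmarsh1986, §10.15, §10.16] -/
theorem jint_side_conditions (C₂ : ℝ) {c e : ℝ} (hc : 0 < c) (hc4 : 4 * c < 1 / 2)
    (hce : 2 * c + e < 1 / 2) :
    ∃ δ₀ : ℝ, 0 < δ₀ ∧ ∀ δ : ℝ, 0 < δ → δ ≤ δ₀ → ∀ x : ℝ, 1 ≤ x → x ≤ δ ^ (-e) →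
      x * (δ ^ (-c)) ^ 2 * Real.sqrt (2 * π * δ) ≤ 1 ∧
      24 * x * (δ ^ (-c)) ^ 2 * (1 + Real.log (δ ^ (-c))) ^ 3 * Real.sqrt δ ≤ 1 ∧
      C₂ * (δ ^ (-c)) ^ 4 * (1 + Real.log (δ ^ (-c)) + Real.log (1 / δ)) ^ 4 * Real.sqrt δ ≤ 1 := by
  obtain ⟨d₁, hd₁, hd₁1, H1⟩ := exists_delta0_log (Real.sqrt (2 * π)) (by linarith : 0 < 1 / 2 - 2 * c - e) 0
  obtain ⟨d₂, hd₂, _, H2⟩ := exists_delta0_log (24 * (1 + c) ^ 3) (by linarith : 0 < 1 / 2 - 2 * c - e) 3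
  obtain ⟨d₃, hd₃, _, H3⟩ := exists_delta0_log (C₂ * (2 + c) ^ 4) (by linarith : 0 < 1 / 2 - 4 * c) 4
  refine ⟨min (min d₁ d₂) (min d₃ (Real.exp (-2))), by positivity, fun δ hδ hδle x hx1 hxe ↦ ?_⟩
  have hδd₁ : δ ≤ d₁ := hδle.trans ((min_le_left _ _).trans (min_le_left _ _))
  have hδd₂ : δ ≤ d₂ := hδle.trans ((min_le_left _ _).trans (min_le_right _ _))
  have hδd₃ : δ ≤ d₃ := hδle.trans ((min_le_right _ _).trans (min_le_left _ _))
  have hδe2 : δ ≤ Real.exp (-2) := hδle.trans ((min_le_right _ _).trans (min_le_right _ _))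
  have hδ1 : δ < 1 := lt_of_le_of_lt hδd₁ hd₁1
  obtain ⟨hlogX, hX0, hXpow⟩ := rpow_neg_facts (c := c) hδ
  set X : ℝ := δ ^ (-c) with hXdef
  set L : ℝ := Real.log (1 / δ) with hL
  have hL2 : 2 ≤ L := by
    rw [hL, one_div, Real.log_inv, le_neg]
    have := Real.log_le_log hδ hδe2
    rwa [Real.log_exp] at this
  have hL0 : 0 < L := by linarith
  have hlogX1 : 1 + Real.log X ≤ (1 + c) * L := by rw [hlogX]; nlinarith
  have hlogX0 : 0 ≤ Real.log X := by rw [hlogX]; positivity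
  have hsqδ : Real.sqrt δ = δ ^ (1 / 2 : ℝ) := Real.sqrt_eq_rpow δ
  have hx0 : 0 ≤ x := by linarith
  have hxe' : x ≤ δ ^ (-e) := hxe
  refine ⟨?_, ?_, ?_⟩
  · have h := H1 δ hδ hδd₁
    rw [pow_zero, mul_one] at h
    calc x * X ^ 2 * Real.sqrt (2 * π * δ) ≤ δ ^ (-e) * X ^ 2 * Real.sqrt (2 * π * δ) := by gcongr
      _ = Real.sqrt (2 * π) * δ ^ (1 / 2 - 2 * c - e) := by
          rw [Real.sqrt_mul (by positivity), hsqδ, hXpow 2,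
            show (1 / 2 - 2 * c - e : ℝ) = -e + -(2 * c) + 1 / 2 by ring, Real.rpow_add hδ, Real.rpow_add hδ]
          push_cast; ring
      _ ≤ 1 := h
  · have h := H2 δ hδ hδd₂
    calc 24 * x * X ^ 2 * (1 + Real.log X) ^ 3 * Real.sqrt δ ≤ 24 * δ ^ (-e) * X ^ 2 * ((1 + c) * L) ^ 3 * Real.sqrt δ := by
          gcongr
      _ = 24 * (1 + c) ^ 3 * δ ^ (1 / 2 - 2 * c - e) * L ^ 3 := by
          rw [hsqδ, hXpow 2, show (1 / 2 - 2 * c - e : ℝ) = -e + -(2 * c) + 1 / 2 by ring, Real.rpow_add hδ,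
            Real.rpow_add hδ]
          push_cast; ring
      _ ≤ 1 := h
  · have h := H3 δ hδ hδd₃
    have hb : 1 + Real.log X + Real.log (1 / δ) ≤ (2 + c) * L := by rw [← hL]; nlinarith
    have hb0 : 0 ≤ 1 + Real.log X + Real.log (1 / δ) := by rw [← hL]; linarith
    calc C₂ * X ^ 4 * (1 + Real.log X + Real.log (1 / δ)) ^ 4 * Real.sqrt δ
        = C₂ * (X ^ 4 * (1 + Real.log X + Real.log (1 / δ)) ^ 4 * Real.sqrt δ) := by ring
      _ ≤ 1 := by
          rcases le_or_gt C₂ 0 with hC | hC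
          · have : 0 ≤ X ^ 4 * (1 + Real.log X + Real.log (1 / δ)) ^ 4 * Real.sqrt δ := by positivity
            nlinarith
          · calc C₂ * (X ^ 4 * (1 + Real.log X + Real.log (1 / δ)) ^ 4 * Real.sqrt δ)
                ≤ C₂ * (X ^ 4 * ((2 + c) * L) ^ 4 * Real.sqrt δ) := by gcongr
              _ = C₂ * (2 + c) ^ 4 * δ ^ (1 / 2 - 4 * c) * L ^ 4 := by
                  rw [hsqδ, hXpow 4, show (1 / 2 - 4 * c : ℝ) = -(4 * c) + 1 / 2 by ring, Real.rpow_add hδ]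
                  push_cast; ring
              _ ≤ 1 := h

/-- **The Gaussian tail is negligible**: `∫_{δ^{-2}}^∞ |g|² ≤ 1` for `X = δ^{-c}`, `c < ⅛`, `δ ≤ δ₀(c)`.
[cite: Titchmarsh1986, §10.18] -/
theorem gaussTail_le_one {c : ℝ} (hc : 0 < c) (hc8 : c < 1 / 8) :
    ∃ δ₀ : ℝ, 0 < δ₀ ∧ ∀ δ : ℝ, 0 < δ → δ ≤ δ₀ →
      ∫ u in Ioi (δ ^ (-(2 : ℝ))), ‖gfun (δ ^ (-c)) δ u‖ ^ 2 ≤ 1 := by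
  obtain ⟨d₅, hd₅, hd₅1, H5⟩ := exists_delta0_exp (3600 * π * Real.exp (2 * π)) 3 (by norm_num : (0 : ℝ) < 3 / 4)
  refine ⟨min d₅ (min (Real.exp (-2)) ((3 : ℝ) ^ (-(1 / c)))), by positivity, fun δ hδ hδle ↦ ?_⟩
  have hδd₅ : δ ≤ d₅ := hδle.trans (min_le_left _ _)
  obtain ⟨_, hX3, hδ1⟩ := regime_basic hc hδ (hδle.trans ((min_le_right _ _).trans (min_le_left _ _)))
    (hδle.trans ((min_le_right _ _).trans (min_le_right _ _)))
  obtain ⟨_, hX0, hXpow⟩ := rpow_neg_facts (c := c) hδ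
  set X : ℝ := δ ^ (-c) with hXdef
  have hX1 : 1 ≤ X := by linarith
  obtain ⟨hsin, _⟩ := sin_cos_bounds hδ hδ1.le
  have hs0 : 0 < Real.sin δ := by linarith
  set x₁ : ℝ := δ ^ (-(2 : ℝ)) with hx₁
  have hx₁1 : 1 ≤ x₁ := Real.one_le_rpow_of_pos_of_le_one_of_nonpos hδ hδ1.le (by norm_num)
  refine (integral_norm_gfun_sq_tail_le hX0 hs0 hx₁1).trans ?_
  have hT := gMajorTot_le hX1 hδ hδ1.le
  have hT0 := gMajorTot_nonneg X δ
  have hc0 : 0 < cZero X δ := div_pos (mul_pos Real.pi_pos hs0) (pow_pos hX0 2)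
  have hc0up : cZero X δ ≤ π := by
    rw [cZero, div_le_iff₀ (pow_pos hX0 2)]
    have : Real.sin δ ≤ 1 := Real.sin_le_one δ
    nlinarith [Real.pi_pos, show (1 : ℝ) ≤ X ^ 2 by nlinarith]
  have hc0low : δ ^ (1 + 2 * c) ≤ cZero X δ := by
    rw [cZero, hXpow 2, le_div_iff₀ (Real.rpow_pos_of_pos hδ _)]
    push_cast
    rw [← Real.rpow_add hδ, show 1 + 2 * c + -(2 * c) = (1 : ℝ) by ring, Real.rpow_one]
    nlinarith [Real.pi_gt_three]
  have h5 := H5 δ hδ hδd₅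
  have hexpx : Real.exp (-(2 * cZero X δ) * x₁) ≤ Real.exp (-δ ^ (-(3 / 4 : ℝ))) := by
    refine Real.exp_le_exp.mpr ?_
    have h1 : δ ^ (-(3 / 4 : ℝ)) ≤ δ ^ (1 + 2 * c) * x₁ := by
      rw [hx₁, ← Real.rpow_add hδ]
      exact Real.rpow_le_rpow_of_exponent_ge hδ hδ1.le (by linarith)
    have h2 : δ ^ (1 + 2 * c) * x₁ ≤ cZero X δ * x₁ := mul_le_mul_of_nonneg_right hc0low (by linarith)
    nlinarith [mul_pos hc0 (show (0:ℝ) < x₁ by linarith)]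
  have hX4 : X ^ 4 = δ ^ (-(4 * c)) := by rw [hXpow 4]; push_cast; ring_nf
  have hsδ : 0 < Real.sqrt δ := Real.sqrt_pos.mpr hδ
  calc (gMajorTot X δ * Real.exp (cZero X δ)) ^ 2 * Real.exp (-(2 * cZero X δ) * x₁) / (2 * cZero X δ)
      ≤ (15 * X ^ 2 / Real.sqrt δ * Real.exp π) ^ 2 * Real.exp (-δ ^ (-(3 / 4 : ℝ))) / (2 * δ ^ (1 + 2 * c)) := by
        gcongr
    _ = (225 / 2 * Real.exp (2 * π)) * (δ ^ (-(4 * c)) * (Real.sqrt δ ^ 2)⁻¹ * (δ ^ (1 + 2 * c))⁻¹) *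
          Real.exp (-δ ^ (-(3 / 4 : ℝ))) := by
        rw [← hX4, show Real.exp (2 * π) = Real.exp π ^ 2 by rw [← Real.exp_nat_mul]; ring_nf]
        field_simp
        norm_num
    _ = (225 / 2 * Real.exp (2 * π)) * δ ^ (-(2 + 6 * c)) * Real.exp (-δ ^ (-(3 / 4 : ℝ))) := by
        rw [Real.sq_sqrt hδ.le]
        have e1 : (δ ^ (1 + 2 * c))⁻¹ = δ ^ (-(1 + 2 * c)) := (Real.rpow_neg hδ.le _).symm
        have e2 : (δ : ℝ)⁻¹ = δ ^ (-(1 : ℝ)) := by rw [Real.rpow_neg hδ.le, Real.rpow_one]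
        rw [e1, e2, ← Real.rpow_add hδ, ← Real.rpow_add hδ]
        ring_nf
    _ ≤ (3600 * π * Real.exp (2 * π)) * δ ^ (-((3 : ℕ) : ℝ)) * Real.exp (-δ ^ (-(3 / 4 : ℝ))) := by
        refine mul_le_mul_of_nonneg_right (mul_le_mul (by nlinarith [Real.pi_gt_three, Real.exp_pos (2 * π)])
          (Real.rpow_le_rpow_of_exponent_ge hδ hδ1.le (by push_cast; linarith)) (by positivity) (by positivity))
          (by positivity)
    _ ≤ 1 := h5

/-! ## §5 Lemma 10.18 -/

set_option maxHeartbeats 1600000 in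
/-- **Titchmarsh's Lemma 10.18** (discharge of the named fact `Titchmarsh1986_lemma_10_18`):
`∫_{-∞}^{∞} F(t)² dt = O(log(1/δ)/(δ^{1/2} log X))` for `X = δ^{-c}`, `0 < c < ⅛`, `δ ≤ δ₀(c)`.
[cite: Titchmarsh1986, §10.18, Lemma 10.18] -/
theorem Titchmarsh1986_lemma_10_18_holds : Titchmarsh1986_lemma_10_18 := by
  intro c hc hc8
  obtain ⟨K, C₂, hK, hC₂, hJ⟩ := Jint_le
  obtain ⟨dJ, hdJ, HJ⟩ := jint_side_conditions C₂ hc (by linarith) (by linarith : 2 * c + 0 < 1 / 2)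
  obtain ⟨dT, hdT, HT⟩ := gaussTail_le_one hc hc8
  obtain ⟨d₄, hd₄, _, H4⟩ := exists_delta0_log (32 * π * c * (2 * (1 + c)) ^ 2) (by linarith : 0 < 1 / 2 - 2 * c) 2
  set d₆ : ℝ := min (Real.exp (-2)) ((3 : ℝ) ^ (-(1 / c))) with hd₆
  refine ⟨32 * π * Real.exp 2 * K + 32 * π + 1, min (min dJ dT) (min d₄ d₆), by positivity, fun δ hδ hδle ↦ ?_⟩
  have hδJ : δ ≤ dJ := hδle.trans ((min_le_left _ _).trans (min_le_left _ _))
  have hδT : δ ≤ dT := hδle.trans ((min_le_left _ _).trans (min_le_right _ _))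
  have hδd₄ : δ ≤ d₄ := hδle.trans ((min_le_right _ _).trans (min_le_left _ _))
  have hδe2 : δ ≤ Real.exp (-2) := hδle.trans ((min_le_right _ _).trans ((min_le_right _ _).trans (min_le_left _ _)))
  have hδ3c : δ ≤ (3 : ℝ) ^ (-(1 / c)) := hδle.trans ((min_le_right _ _).trans ((min_le_right _ _).trans (min_le_right _ _)))
  obtain ⟨hL2, hX3, hδ1⟩ := regime_basic hc hδ hδe2 hδ3c
  obtain ⟨hlogX, hX0, hXpow⟩ := rpow_neg_facts (c := c) hδ
  set X : ℝ := δ ^ (-c) with hXdef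
  set L : ℝ := Real.log (1 / δ) with hL
  have hL0 : 0 < L := by linarith
  have hX1 : 1 ≤ X := by linarith
  have hlogX1 : 1 + Real.log X ≤ (1 + c) * L := by rw [hlogX]; nlinarith
  have hlogX0 : 0 < Real.log X := by rw [hlogX]; positivity
  have hsδ : 0 < Real.sqrt δ := Real.sqrt_pos.mpr hδ
  have hsδ1 : Real.sqrt δ ≤ 1 := Real.sqrt_le_one.mpr hδ1.le
  have hsqδ : Real.sqrt δ = δ ^ (1 / 2 : ℝ) := Real.sqrt_eq_rpow δ
  obtain ⟨hsin, _⟩ := sin_cos_bounds hδ hδ1.le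
  have hs0 : 0 < Real.sin δ := by linarith
  have hcs : 0 < c * Real.sqrt δ := by positivity
  have hcs1 : c * Real.sqrt δ ≤ 1 := by nlinarith
  have htarget : Real.log (1 / δ) / (Real.sqrt δ * Real.log X) = 1 / (c * Real.sqrt δ) := by
    rw [hlogX, ← hL]; field_simp
  refine ⟨(integral_selbergF_sq_eq hδ hδ1.le X).1, ?_⟩
  rw [mul_div_assoc, htarget]
  -- (a) the `J`-part on `[1, δ^{-2}]`
  set θ : ℝ := 1 / L with hθ
  have hθ0 : 0 < θ := by positivity
  have hθ1 : θ ≤ 1 / 2 := by rw [hθ]; exact div_le_div_of_nonneg_left zero_le_one two_pos hL2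
  set x₁ : ℝ := δ ^ (-(2 : ℝ)) with hx₁
  have hx₁1 : 1 ≤ x₁ := Real.one_le_rpow_of_pos_of_le_one_of_nonpos hδ hδ1.le (by norm_num)
  have hx₁θ : x₁ ^ θ = Real.exp 2 := by
    rw [hx₁, ← Real.rpow_mul hδ.le, Real.rpow_def_of_pos hδ, hθ, hL]
    have hlog1 : Real.log (1 / δ) = -Real.log δ := by rw [one_div, Real.log_inv]
    rw [hlog1]
    congr 1
    have : Real.log δ ≠ 0 := by
      intro h0; rw [hL, hlog1, h0, neg_zero] at hL0; exact lt_irrefl _ hL0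
    field_simp
  obtain ⟨hc1, hc2, hc3⟩ := HJ δ hδ hδJ 1 le_rfl (by rw [neg_zero, Real.rpow_zero])
  have hJ1 := hJ X hX3 δ hδ hδ1.le θ hθ0 hθ1 1 le_rfl hc1 hc2 hc3
  rw [Real.one_rpow, mul_one] at hJ1
  have hpartA : ∫ u in Ioc 1 x₁, ‖gfun X δ u‖ ^ 2 ≤ Real.exp 2 * K / (c * Real.sqrt δ) := by
    refine (integral_Ioc_norm_gfun_sq_le hX0 hs0 hθ0.le hx₁1).trans ?_
    rw [hx₁θ, mul_div_assoc]
    refine mul_le_mul_of_nonneg_left (hJ1.trans (le_of_eq ?_)) (Real.exp_pos _).le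
    rw [hθ, hlogX]; field_simp
  -- (b) the Gaussian tail beyond `δ^{-2}`
  have hpartB : ∫ u in Ioi x₁, ‖gfun X δ u‖ ^ 2 ≤ 1 := HT δ hδ hδT
  -- (c) the `P₀²` term
  have hpartC : 8 * π * phiProd X ^ 2 ≤ 1 / (c * Real.sqrt δ) := by
    have hP := abs_phiProd_le hX1
    have h4 := H4 δ hδ hδd₄
    rw [le_div_iff₀ hcs]
    have hP2 : phiProd X ^ 2 ≤ (2 * X * (1 + Real.log X)) ^ 2 := by
      calc phiProd X ^ 2 = |phiProd X| ^ 2 := (sq_abs _).symm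
        _ ≤ _ := pow_le_pow_left₀ (abs_nonneg _) hP 2
    have hP3 : (2 * X * (1 + Real.log X)) ^ 2 ≤ (2 * X * ((1 + c) * L)) ^ 2 := by gcongr
    have hX2 : X ^ 2 = δ ^ (-(2 * c)) := by rw [hXpow 2]; push_cast; ring_nf
    calc 8 * π * phiProd X ^ 2 * (c * Real.sqrt δ) ≤ 8 * π * (2 * X * ((1 + c) * L)) ^ 2 * (c * Real.sqrt δ) := by
          gcongr 8 * π * ?_ * _
          exact hP2.trans hP3
      _ = 32 * π * c * (1 + c) ^ 2 * (X ^ 2 * Real.sqrt δ) * L ^ 2 := by ring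
      _ = 32 * π * c * (1 + c) ^ 2 * δ ^ (1 / 2 - 2 * c) * L ^ 2 := by
          rw [hX2, hsqδ, ← Real.rpow_add hδ, show (-(2 * c) + 1 / 2 : ℝ) = 1 / 2 - 2 * c by ring]
      _ ≤ 32 * π * c * (2 * (1 + c)) ^ 2 * δ ^ (1 / 2 - 2 * c) * L ^ 2 := by
          have hsq : (1 + c) ^ 2 ≤ (2 * (1 + c)) ^ 2 := by nlinarith
          have h0 : 0 ≤ 32 * π * c := by positivity
          have h1 : 0 ≤ δ ^ (1 / 2 - 2 * c) * L ^ 2 := by positivity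
          nlinarith [mul_le_mul_of_nonneg_left hsq h0, mul_nonneg (mul_nonneg h0 (by positivity : (0:ℝ) ≤ (2 * (1 + c)) ^ 2 - (1 + c) ^ 2)) h1]
      _ ≤ 1 := h4
  -- assemble
  have hsplit : ∫ x in Ioi (1 : ℝ), ‖gfun X δ x‖ ^ 2 =
      (∫ u in Ioc 1 x₁, ‖gfun X δ u‖ ^ 2) + ∫ u in Ioi x₁, ‖gfun X δ u‖ ^ 2 := by
    have hdisj : Disjoint (Ioc (1 : ℝ) x₁) (Ioi x₁) := Set.disjoint_left.mpr fun u hu hu' ↦ (not_lt.mpr hu.2) hu'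
    rw [← Ioc_union_Ioi_eq_Ioi hx₁1, setIntegral_union hdisj
      measurableSet_Ioi ((integrableOn_norm_gfun_sq hX0 hs0 le_rfl).mono_set Ioc_subset_Ioi_self)
      (integrableOn_norm_gfun_sq hX0 hs0 hx₁1)]
  have hmain := integral_selbergF_sq_le hδ hδ1.le hX0 (X := X)
  rw [hsplit] at hmain
  have hcs' : 1 ≤ 1 / (c * Real.sqrt δ) := by rw [le_div_iff₀ hcs]; linarith
  set D : ℝ := 1 / (c * Real.sqrt δ) with hD
  have hπ := Real.pi_pos
  calc ∫ t : ℝ, selbergF X δ t ^ 2 ≤ 32 * π * (Real.exp 2 * K * D + 1) + D := by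
        refine hmain.trans ?_
        have hA' : ∫ u in Ioc 1 x₁, ‖gfun X δ u‖ ^ 2 ≤ Real.exp 2 * K * D := by rw [hD, mul_one_div]; exact hpartA
        nlinarith [add_le_add hA' hpartB]
    _ ≤ (32 * π * Real.exp 2 * K + 32 * π + 1) * D := by
        have : (32 * π * Real.exp 2 * K + 32 * π + 1) * D = 32 * π * (Real.exp 2 * K * D) + 32 * π * D + D := by ring
        rw [this]
        nlinarith

end Literature.NumberTheory.LFunctions.SelbergMollifier
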